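import Summits.ResolutionOfSingularities.ResolutionOfSingularities.Theorems.EquisingularLiftEquisingularLiftNatMultisectionExists
import HarnessLib

/-!
# [OURS · L1 W4.5(b) · EL♮] T-MULTISEC — discharging the inputs of `exists_multisection` (horizontality, admissibility)
# (crux `EquisingularLiftNat` = stmt-ResolutionOfSingularities-20038)

HONEST FRAMING. OURS (cell res-hironaka, crux chain w45b, slot W4.5(b)); NOT a statement of any manuscript; AI-written,
weaker than expert review. Helper `--supports stmt-ResolutionOfSingularities-20038 --as helper`; inputs of the ADAPTER
`hMS` := T-MULTISEC ⇒ T-TAIL (res-D-pv-013 2026-08-27T07:37:46Z).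

* `injective_stalkHom_of_isIntegral` (L-INJ) — for an INTEGRAL scheme `r : P → Spec O` having a point `x` over the generic
  point of `Spec O` (`(r x).asIdeal = ⊥`), the structure map `O → 𝒪_{P,b}` is injective at EVERY point `b` (germs of global
  functions on an integral scheme are injective, and a function `a ∈ O` vanishing at a point over the generic point is `0`).
(L-ADM «embedding dimension drop ⇒ ∃ u ∈ I_T ∖ 𝔪²» and L-RAT «k-rational special points» follow in sibling files.)

References: folklore (germs on integral schemes, Mathlib `germ_injective_of_isIntegral`).
-/

set_option linter.dupNamespace false -- mandated namespace `Summit.<Summit>.<Problem>` of this single-conjunct summit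

open CategoryTheory AlgebraicGeometry TopologicalSpace Topology IsLocalRing
open AlgebraicGeometry.Scheme.IdealSheafData Literature.AlgebraicGeometry.Resolution

namespace Summit.ResolutionOfSingularities.ResolutionOfSingularities.Cruxes.EquisingularLiftNat.Sections

/-! ## L-INJ: horizontality of an integral stage -/

/-- **L-INJ.** Let `P` be an INTEGRAL scheme over a domain `O`, `r : P → Spec O`, with a point `x` over the generic point of
`Spec O` (`(r x).asIdeal = ⊥`). Then for every `b ∈ P` the structure map `O → 𝒪_{P,b}` (germs of pulled-back functions) is
injective: if the germ at `b` of `r^*a` vanishes then `r^*a = 0` on the integral `P` (Mathlib `Scheme.germ_injective_of_isIntegral`),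
so `r^*a` vanishes at `x`, i.e. `a ∈ (r x).asIdeal = 0`. [folklore] -/
theorem injective_stalkHom_of_isIntegral {O : Type} [CommRing O] {P : Scheme.{0}} [AlgebraicGeometry.IsIntegral P]
    (r : P ⟶ Spec (.of O)) {x : P} (hx : (r x).asIdeal = ⊥) (b : P) :
    Function.Injective ((Scheme.ΓSpecIso (.of O)).inv ≫ (Spec (.of O)).presheaf.germ ⊤ (r b) trivial ≫ r.stalkMap b).hom := by
  intro a₁ a₂ h
  rw [← sub_eq_zero] at h ⊢
  set a := a₁ - a₂ with ha
  rw [← map_sub] at h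
  -- the germ at `b` of the global function `r^* a` vanishes, hence `r^* a = 0`
  have h1 : P.presheaf.germ ⊤ b trivial (r.appTop ((Scheme.ΓSpecIso (.of O)).inv a)) = 0 := by
    have := h
    simp only [CommRingCat.hom_comp, RingHom.coe_comp, Function.comp_apply] at this
    rwa [Scheme.Hom.germ_stalkMap_apply] at this
  have h2 : r.appTop ((Scheme.ΓSpecIso (.of O)).inv a) = 0 :=
    germ_injective_of_isIntegral P (U := ⊤) b trivial (h1.trans (map_zero _).symm)
  -- so `a` vanishes at the point `x` over the generic point: `a ∈ (r x).asIdeal = ⊥`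
  have h3 : x ∈ P.zeroLocus ({r.appTop ((Scheme.ΓSpecIso (.of O)).inv a)} : Set Γ(P, ⊤)) := by
    rw [h2, Scheme.mem_zeroLocus_iff]
    intro f hf
    rw [Set.mem_singleton_iff.mp hf, Scheme.basicOpen_zero]
    exact id
  have h4 : r x ∈ (Spec (.of O)).zeroLocus ({(Scheme.ΓSpecIso (.of O)).inv a} : Set Γ(Spec (.of O), ⊤)) := by
    rw [← Set.mem_preimage, Scheme.preimage_zeroLocus, Set.image_singleton]
    exact h3
  have h5 := Spec_zeroLocus_eq_zeroLocus (R := .of O) {a}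
  rw [Set.image_singleton] at h5
  rw [h5] at h4
  have h6 : a ∈ (r x).asIdeal := (PrimeSpectrum.mem_zeroLocus _ _).mp h4 (Set.mem_singleton a)
  rw [hx, Ideal.mem_bot] at h6
  exact h6

end Summit.ResolutionOfSingularities.ResolutionOfSingularities.Cruxes.EquisingularLiftNat.Sections
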